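import Summits.QuantumFields.YangMills.Theorems.Instrument.BesselCapSU2D4
import Summits.QuantumFields.GaugeBoot.BesselCapCheck
import Summits.QuantumFields.GaugeBoot.WordRectangle
import Summits.QuantumFields.GaugeBoot.BesselCapRectangle
import HarnessLib

/-!
# YM instrument cell — `SU(2)`, `D = 4`: Bessel-cap ROWS from one kernel check per word (A-plan-11; per-row binding)

Cell `ym-instrument` (HUMAN RULING D-0084 (2); director-ym R138; HOME `run/shared/lean/pub/ym-instrument/`), crew (a),
Lean typist seat `ym-instrument-boot-lean-1`. Question Q-A1, amendments A-plan-10 and A-plan-11 «BESSEL CAP»; ladder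
consequence: the «| cap» rows of TABLE-A1 (IR `stmt-QuantumFields-19354`, THE NUMBER) — per-variable boxes
`|y_v| ≤ ρ^{m(v)}` and the stand-alone caps on `W̄(1×2)`, `W̄(2×2)`.

HONEST FRAMING (page 1 of every file of this cell): WHAT IS CERTIFIED HERE, AT WHICH `(G, D, L, β)`: `G = SU(2)`
(fundamental, standard Wilson action), `D = 4`, EVERY periodic lattice `(ℤ/L)⁴` with `L ≥ L₀` (`L₀` printed in each
theorem, even or odd `L`), `β_std ∈ {9/5, 2, 11/5, 12/5}` (and general `β` with a point hypothesis on `I₂/I₁(6β)`):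
(i) the BINDING RULE `abs_W_le_pow_of_capCheck` — one `decide` of `GaugeBoot.capCheck w FZ L₀` on the word `w` and a
witness link list `FZ ⊂ ℤ⁴ × {axes}` gives `|⟨W_0(w)⟩_{(ℤ/L)⁴,β}| ≤ ρ(β)^{|FZ|}` for ALL `L ≥ L₀` (no-wrap transfer of file
`GaugeBoot/WordEdgesZ`, checker soundness `GaugeBoot/capCheck_sound`, cap `GaugeBoot/BesselCap`); (ii) the first rows:
`|W̄(2×2)| ≤ ρ⁴` and `|W̄(1×2)| ≤ ρ²` at the four Q-A1 couplings for every `L ≥ 5` (`ρ⁴ = 0.5750… (9/5), 0.6074… (2),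
0.6354… (11/5), 0.6599… (12/5)` — boot-plan A-plan-11 v2 §2 "stand-alone Class-A cap"). These are fixed-coupling,
`R`-independent perimeter-type bounds; NOT an area law, NOT a string tension, NOT a mass gap, no continuum or large-`N`
statement; nothing summit-bearing; no hypothesis is left to the reader.
-/

noncomputable section

namespace Summit.QuantumFields.YangMills.Theorems.Instrument

open Summit.QuantumFields.GaugeBoot
open Literature.MathematicalPhysics.QuantumFieldTheory
open Literature.Analysis.FunctionSpaces (besselI)

/-! ## The binding rule: one kernel check per (word, witness) -/

/-- **BINDING RULE (general `β`).** If `capCheck w FZ L₀ = true` then for every torus `L ≥ L₀`: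
`|⟨W_0(w)⟩_β| ≤ ρ^{|FZ|}` whenever `0 < β`, `0 ≤ ρ` and `I₂(6β)/I₁(6β) ≤ ρ`. [folklore] -/
theorem abs_W_le_pow_of_capCheck {β ρ : ℝ} (hβ : 0 < β) (hρ0 : 0 ≤ ρ)
    (hρ : besselI 2 (6 * β) / besselI 1 (6 * β) ≤ ρ) {w : Word 4} {FZ : List (EdgeZ 4)} {L₀ : ℕ}
    (h : capCheck w FZ L₀ = true) (L : ℕ) [NeZero L] (hL : L₀ ≤ L) : |Rung0D4.W β L w| ≤ ρ ^ FZ.length := by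
  obtain ⟨h1, hcard, hF1, hF2⟩ := capCheck_sound h hL (0 : Site 4 L)
  rw [← hcard]
  exact abs_W_le_pow_of_besselRatio_le hβ hρ0 hρ L h1 w _ hF1 hF2

/-- **BINDING RULE at `β_std = 9/5`**: `capCheck w FZ L₀ = true ⟹ |⟨W_0(w)⟩| ≤ (2177/2500)^{|FZ|}` on every torus `L ≥ L₀`.
[folklore] -/
theorem cap_b9o5_of_capCheck {w : Word 4} {FZ : List (EdgeZ 4)} {L₀ : ℕ} (h : capCheck w FZ L₀ = true) (L : ℕ)
    [NeZero L] (hL : L₀ ≤ L) : |Rung0D4.W (9 / 5) L w| ≤ (2177 / 2500 : ℝ) ^ FZ.length :=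
  abs_W_le_pow_of_capCheck (by norm_num) (by norm_num) besselRatio_b9o5_le h L hL

/-- **BINDING RULE at `β_std = 2`**: `|⟨W_0(w)⟩| ≤ (2207/2500)^{|FZ|}`. [folklore] -/
theorem cap_b2_of_capCheck {w : Word 4} {FZ : List (EdgeZ 4)} {L₀ : ℕ} (h : capCheck w FZ L₀ = true) (L : ℕ)
    [NeZero L] (hL : L₀ ≤ L) : |Rung0D4.W 2 L w| ≤ (2207 / 2500 : ℝ) ^ FZ.length :=
  abs_W_le_pow_of_capCheck (by norm_num) (by norm_num) besselRatio_b2_le h L hL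

/-- **BINDING RULE at `β_std = 11/5`**: `|⟨W_0(w)⟩| ≤ (558/625)^{|FZ|}`. [folklore] -/
theorem cap_b11o5_of_capCheck {w : Word 4} {FZ : List (EdgeZ 4)} {L₀ : ℕ} (h : capCheck w FZ L₀ = true) (L : ℕ)
    [NeZero L] (hL : L₀ ≤ L) : |Rung0D4.W (11 / 5) L w| ≤ (558 / 625 : ℝ) ^ FZ.length :=
  abs_W_le_pow_of_capCheck (by norm_num) (by norm_num) besselRatio_b11o5_le h L hL

/-- **BINDING RULE at `β_std = 12/5`**: `|⟨W_0(w)⟩| ≤ (9013/10000)^{|FZ|}`. [folklore] -/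
theorem cap_b12o5_of_capCheck {w : Word 4} {FZ : List (EdgeZ 4)} {L₀ : ℕ} (h : capCheck w FZ L₀ = true) (L : ℕ)
    [NeZero L] (hL : L₀ ≤ L) : |Rung0D4.W (12 / 5) L w| ≤ (9013 / 10000 : ℝ) ^ FZ.length :=
  abs_W_le_pow_of_capCheck (by norm_num) (by norm_num) besselRatio_b12o5_le h L hL

/-! ## Witnesses for the `1×2` and `2×2` loops -/

/-- Cap witness for `W̄(2×2)` (`Word.rectangle 0 1 2 2`): the four links in direction `1` on the two columns `x₀ ∈ {0, 2}`,
at distance `2` (no common plaquette), each read once. [folklore] -/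
def links22 : List (EdgeZ 4) :=
  [(![2, 0, 0, 0], 1), (![2, 1, 0, 0], 1), (![0, 1, 0, 0], 1), (![0, 0, 0, 0], 1)]

/-- Cap witness for `W̄(1×2)` (`Word.rectangle 0 1 1 2`): the two collinear links of the column `x₀ = 1`. [folklore] -/
def links12 : List (EdgeZ 4) := [(![1, 0, 0, 0], 1), (![1, 1, 0, 0], 1)]

/-- The checker accepts the `2×2` witness with threshold `L₀ = 5`. [folklore] -/
theorem capCheck_rect22 : capCheck (Word.rectangle (0 : Fin 4) 1 2 2) links22 5 = true := by
  decide +kernel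

/-- The checker accepts the `1×2` witness with threshold `L₀ = 5`. [folklore] -/
theorem capCheck_rect12 : capCheck (Word.rectangle (0 : Fin 4) 1 1 2) links12 5 = true := by
  decide +kernel

/-- The torus-averaged Wilson loop of the tree is the based rectangle word loop (`WordRectangle`), `N = 2`, `D = 4`. [folklore] -/
theorem wilsonLoopExpectation_two_four_eq (L : ℕ) [NeZero L] (β : ℝ) (R T : ℕ) :
    wilsonLoopExpectation 2 4 L β R T = Rung0D4.W β L (Word.rectangle (0 : Fin 4) 1 R T) := by
  rw [wilsonLoopExpectation_eq_wordLoop 2 4 L β R T (0 : Site 4 L) (show (0 : Fin 4) ≠ 1 by decide)]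
  rfl

/-! ## Rows: stand-alone caps on `W̄(2×2)` and `W̄(1×2)` at the Q-A1 couplings, every torus `L ≥ 5` -/

/-- **`|W̄(2×2)| ≤ (558/625)⁴ = 0.63536…` at `β_std = 11/5`**, `SU(2)`, `D = 4`, every torus `L ≥ 5`. [folklore] -/
theorem abs_wilsonLoop22_le_SU2_D4_b11o5 (L : ℕ) [NeZero L] (hL : 5 ≤ L) :
    |wilsonLoopExpectation 2 4 L (11 / 5) 2 2| ≤ (558 / 625 : ℝ) ^ 4 := by
  rw [wilsonLoopExpectation_two_four_eq]; exact cap_b11o5_of_capCheck capCheck_rect22 L hL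

/-- **`|W̄(2×2)| ≤ (2177/2500)⁴ = 0.57504…` at `β_std = 9/5`**, every torus `L ≥ 5`. [folklore] -/
theorem abs_wilsonLoop22_le_SU2_D4_b9o5 (L : ℕ) [NeZero L] (hL : 5 ≤ L) :
    |wilsonLoopExpectation 2 4 L (9 / 5) 2 2| ≤ (2177 / 2500 : ℝ) ^ 4 := by
  rw [wilsonLoopExpectation_two_four_eq]; exact cap_b9o5_of_capCheck capCheck_rect22 L hL

/-- **`|W̄(2×2)| ≤ (2207/2500)⁴ = 0.60740…` at `β_std = 2`**, every torus `L ≥ 5`. [folklore] -/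
theorem abs_wilsonLoop22_le_SU2_D4_b2 (L : ℕ) [NeZero L] (hL : 5 ≤ L) :
    |wilsonLoopExpectation 2 4 L 2 2 2| ≤ (2207 / 2500 : ℝ) ^ 4 := by
  rw [wilsonLoopExpectation_two_four_eq]; exact cap_b2_of_capCheck capCheck_rect22 L hL

/-- **`|W̄(2×2)| ≤ (9013/10000)⁴ = 0.65990…` at `β_std = 12/5`**, every torus `L ≥ 5`. [folklore] -/
theorem abs_wilsonLoop22_le_SU2_D4_b12o5 (L : ℕ) [NeZero L] (hL : 5 ≤ L) :
    |wilsonLoopExpectation 2 4 L (12 / 5) 2 2| ≤ (9013 / 10000 : ℝ) ^ 4 := by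
  rw [wilsonLoopExpectation_two_four_eq]; exact cap_b12o5_of_capCheck capCheck_rect22 L hL

/-- **`|W̄(1×2)| ≤ (558/625)² = 0.79709…` at `β_std = 11/5`**, every torus `L ≥ 5`. [folklore] -/
theorem abs_wilsonLoop12_le_SU2_D4_b11o5 (L : ℕ) [NeZero L] (hL : 5 ≤ L) :
    |wilsonLoopExpectation 2 4 L (11 / 5) 1 2| ≤ (558 / 625 : ℝ) ^ 2 := by
  rw [wilsonLoopExpectation_two_four_eq]; exact cap_b11o5_of_capCheck capCheck_rect12 L hL

/-- **`|W̄(1×2)| ≤ (2177/2500)² = 0.75829…` at `β_std = 9/5`**, every torus `L ≥ 5`. [folklore] -/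
theorem abs_wilsonLoop12_le_SU2_D4_b9o5 (L : ℕ) [NeZero L] (hL : 5 ≤ L) :
    |wilsonLoopExpectation 2 4 L (9 / 5) 1 2| ≤ (2177 / 2500 : ℝ) ^ 2 := by
  rw [wilsonLoopExpectation_two_four_eq]; exact cap_b9o5_of_capCheck capCheck_rect12 L hL

/-- **`|W̄(1×2)| ≤ (2207/2500)²` at `β_std = 2`**, every torus `L ≥ 5`. [folklore] -/
theorem abs_wilsonLoop12_le_SU2_D4_b2 (L : ℕ) [NeZero L] (hL : 5 ≤ L) :
    |wilsonLoopExpectation 2 4 L 2 1 2| ≤ (2207 / 2500 : ℝ) ^ 2 := by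
  rw [wilsonLoopExpectation_two_four_eq]; exact cap_b2_of_capCheck capCheck_rect12 L hL

/-- **`|W̄(1×2)| ≤ (9013/10000)²` at `β_std = 12/5`**, every torus `L ≥ 5`. [folklore] -/
theorem abs_wilsonLoop12_le_SU2_D4_b12o5 (L : ℕ) [NeZero L] (hL : 5 ≤ L) :
    |wilsonLoopExpectation 2 4 L (12 / 5) 1 2| ≤ (9013 / 10000 : ℝ) ^ 2 := by
  rw [wilsonLoopExpectation_two_four_eq]; exact cap_b12o5_of_capCheck capCheck_rect12 L hL

/-! ## Symbolic rectangles (appended): `|W̄(R×T)| ≤ ρ^{2T}` for EVERY `R ≥ 2`, EVERY `T`, every torus `L ≥ max(R,T) + 3`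

The witness is `GaugeBoot.columnLinks` (both sides in direction `j`), accepted by the checker for symbolic `R, T`
(`GaugeBoot.capCheck_rectangle`). This is the torus-level input of the class-LIMIT support cap `supp μ_R ⊂ [0, ρ²]`
(boot-plan A-plan-11 v2 §1 (B2)): along any sequence of tori, `g_R(T) = ⟨W̄(R×T)⟩ ≤ ρ^{2T}` for all `T` eventually in `L`.
HONEST FRAMING: an `R`-independent perimeter-type bound; not an area law. -/

/-- **`|⟨W̄(R×T)⟩_β| ≤ ρ^{2T}`** for `SU(2)`, `D = 4`, `R ≥ 2`, every `T`, every torus `L` with `R + 3 ≤ L`, `T + 3 ≤ L`,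
whenever `0 < β`, `0 ≤ ρ`, `I₂(6β)/I₁(6β) ≤ ρ`. [folklore] -/
theorem abs_wilsonLoop_le_pow_of_besselRatio_le {β ρ : ℝ} (hβ : 0 < β) (hρ0 : 0 ≤ ρ)
    (hρ : besselI 2 (6 * β) / besselI 1 (6 * β) ≤ ρ) {R T : ℕ} (hR : 2 ≤ R) (L : ℕ) [NeZero L]
    (hRL : R + 3 ≤ L) (hTL : T + 3 ≤ L) : |wilsonLoopExpectation 2 4 L β R T| ≤ ρ ^ (2 * T) := by
  rw [wilsonLoopExpectation_two_four_eq, ← length_columnLinks (0 : Fin 4) 1 R T]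
  exact abs_W_le_pow_of_capCheck hβ hρ0 hρ (capCheck_rectangle 0 1 (by decide) hR hRL hTL) L le_rfl

/-- **`|⟨W̄(R×T)⟩| ≤ (2177/2500)^{2T}` at `β_std = 9/5`** (`R ≥ 2`, all `T`, every torus `L ≥ max(R,T)+3`). [folklore] -/
theorem abs_wilsonLoop_le_pow_SU2_D4_b9o5 {R T : ℕ} (hR : 2 ≤ R) (L : ℕ) [NeZero L] (hRL : R + 3 ≤ L)
    (hTL : T + 3 ≤ L) : |wilsonLoopExpectation 2 4 L (9 / 5) R T| ≤ (2177 / 2500 : ℝ) ^ (2 * T) :=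
  abs_wilsonLoop_le_pow_of_besselRatio_le (by norm_num) (by norm_num) besselRatio_b9o5_le hR L hRL hTL

/-- **`|⟨W̄(R×T)⟩| ≤ (2207/2500)^{2T}` at `β_std = 2`**. [folklore] -/
theorem abs_wilsonLoop_le_pow_SU2_D4_b2 {R T : ℕ} (hR : 2 ≤ R) (L : ℕ) [NeZero L] (hRL : R + 3 ≤ L)
    (hTL : T + 3 ≤ L) : |wilsonLoopExpectation 2 4 L 2 R T| ≤ (2207 / 2500 : ℝ) ^ (2 * T) :=
  abs_wilsonLoop_le_pow_of_besselRatio_le (by norm_num) (by norm_num) besselRatio_b2_le hR L hRL hTL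

/-- **`|⟨W̄(R×T)⟩| ≤ (558/625)^{2T}` at `β_std = 11/5`**. [folklore] -/
theorem abs_wilsonLoop_le_pow_SU2_D4_b11o5 {R T : ℕ} (hR : 2 ≤ R) (L : ℕ) [NeZero L] (hRL : R + 3 ≤ L)
    (hTL : T + 3 ≤ L) : |wilsonLoopExpectation 2 4 L (11 / 5) R T| ≤ (558 / 625 : ℝ) ^ (2 * T) :=
  abs_wilsonLoop_le_pow_of_besselRatio_le (by norm_num) (by norm_num) besselRatio_b11o5_le hR L hRL hTL

/-- **`|⟨W̄(R×T)⟩| ≤ (9013/10000)^{2T}` at `β_std = 12/5`**. [folklore] -/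
theorem abs_wilsonLoop_le_pow_SU2_D4_b12o5 {R T : ℕ} (hR : 2 ≤ R) (L : ℕ) [NeZero L] (hRL : R + 3 ≤ L)
    (hTL : T + 3 ≤ L) : |wilsonLoopExpectation 2 4 L (12 / 5) R T| ≤ (9013 / 10000 : ℝ) ^ (2 * T) :=
  abs_wilsonLoop_le_pow_of_besselRatio_le (by norm_num) (by norm_num) besselRatio_b12o5_le hR L hRL hTL

end Summit.QuantumFields.YangMills.Theorems.Instrument

end
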